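import Summits.CriticalPhenomena.PercolationContinuityZ3.Theorems.PercNearOneGluingNoHeavyQuantFarEarAtObserverLaw
import Summits.CriticalPhenomena.PercolationContinuityZ3.Theorems.PercNearOneGluingNoHeavyQuantFarEarAtObserverMoments
import Summits.CriticalPhenomena.PercolationContinuityZ3.Theorems.PercNearOneGluingNoHeavyQuantFarEarAtObserverArith
import HarnessLib

/-!
# QUANT lane R8, front "FAR beyond trees", layer one — **FAR(1) HOLDS ON EVERY GRAPH WITH A TWO-RELAY EAR AT THE OBSERVER**

builds on p205010 (kernel theorem, internal audit signed; external expert review pending)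

Support file (`--supports stmt-CriticalPhenomena-4575`), seat `prim-quant-p1` (gen 26); memo
`run/shared/lean/prim/quant/prim-quant-p1-g26/FOR-LEAD-EAR-AT-OBSERVER.md`.  Standard axioms; no sorries; no definitions.

**THEOREM (`Quant.farLayerOne_of_earAtObserver`).**  Let `w` be any weight function on the pairs of `Fin n`, `A` a relay set, `o` the
observer.  Suppose some relay `v ∈ A`, `v ≠ o`, has positive weight only towards the observer (`s(o, v)`, weight `p`) and towards ONE
further relay `u ∈ A` (`s(v, u)`, weight `r`; `u ≠ o, v`, with arbitrary further pairs) — i.e. `w s(v, z) = 0` for `z ∉ {o, u, v}`.  Then the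
layer-one instance of the far-relay row `Quant.FarRelayRow` holds at `(w, A, o)`:
`2 < Σ_{a∈A} P(o ↔ a)` and `P(o ↮ a) ≤ t` for all `a ∈ A` imply `P(#{a ∈ A : o ↔ a} ≤ 1) ≤ t`.

This is the two-terminal EAR₂ configuration of p1 g25's memo (`FOR-LEAD-TWOTERMINAL.md` §10(e): a 2-relay ear `c₁ – v₁ – v₂ – c₂` in an
arbitrary environment) in the case where THE OBSERVER IS A TERMINAL (`o = c₂`, `v₂ = v`, `v₁ = u`; the ear's third pair `s(u, c₁)` is just
one of `u`'s arbitrary pairs).  Unlike the general-observer case (where the two-terminal LP over Harris/cluster-decoupling rows is NOT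
tight, g25 §4), here FAR(1) follows from the hypotheses by LINEAR BOOKKEEPING over the off-`v` law (`…EarAtObserverArith`: regime
`n'p ≥ (1−p)(1−pr)` needs no mean hypothesis at all; regime `n'p < (1−p)(1−pr)` uses `EN > 2` once), because the pair `s(o,v)` is an
independent coin feeding the observer's count directly.  New unconditional layer-one coverage: every graph in which the observer is adjacent to a
degree-two relay whose other neighbour is a relay (in particular every 2-relay ear with the observer at a terminal); a minimal counterexample
to FAR(1) therefore has no such ear.
[cite: KozmaNitzan2024, Conjecture 3 (p. 15)] (the row served); [cite: Grimmett1999, §1.3 p. 10, §2.2]; [this work].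
-/

noncomputable section

namespace Summit.CriticalPhenomena.PercolationContinuityZ3.Theorems

namespace Quant

open Finset MeasureTheory Set
open Literature.Probability.LatticeModels
open Literature.Probability.Percolation
open Bundle (offZ)
open scoped Classical

variable {n : ℕ}

/-- **FAR at layer one with a two-relay ear at the observer.**  If `v ∈ A` (`v ≠ o`) has positive weight only on `s(o, v)` and on `s(v, u)`
for a relay `u ∈ A` (`u ≠ o`, `u ≠ v`), then `2 < Σ_{a∈A} P(o ↔ a)` and `P(o ↮ a) ≤ t` on `A` imply `P(#{a ∈ A : o ↔ a} ≤ 1) ≤ t`. [this work] -/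
theorem farLayerOne_of_earAtObserver (w : Sym2 (Fin n) → unitInterval) (A : Finset (Fin n)) {o v u : Fin n}
    (hov : o ≠ v) (huv : u ≠ v) (hou : o ≠ u) (hvA : v ∈ A) (huA : u ∈ A)
    (hw : ∀ z : Fin n, z ≠ o → z ≠ u → z ≠ v → (w s(v, z) : ℝ) = 0) (t : ℝ)
    (hEN : 2 < ∑ a ∈ A, (prodBernoulli w).real (openConn o a))
    (hcut : ∀ a ∈ A, (prodBernoulli w).real (openConn o a : Set (BondConfig (Fin n)))ᶜ ≤ t) :
    (prodBernoulli w).real {ω : BondConfig (Fin n) | (A.filter fun a => ω ∈ openConn o a).card ≤ 1} ≤ t := by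
  set μ := prodBernoulli w with hμ
  have hmeas : ∀ U : Set (BondConfig (Fin n)), MeasurableSet U := fun U => (Set.toFinite U).measurableSet
  -- the two ear weights
  set p : ℝ := (w s(o, v) : ℝ) with hp
  set r : ℝ := (w s(v, u) : ℝ) with hr
  have hp0 : 0 ≤ p := (w s(o, v)).2.1
  have hp1 : p ≤ 1 := (w s(o, v)).2.2
  have hr0 : 0 ≤ r := (w s(v, u)).2.1
  have hr1 : r ≤ 1 := (w s(v, u)).2.2
  -- the off-`v` events
  set Gs := {ω : BondConfig (Fin n) | offZ {v} ω ∈ openConn o u} with hGs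
  set X0 := {ω : BondConfig (Fin n) | ((A.erase v).filter fun a => offZ {v} ω ∈ openConn o a).card = 0} with hX0
  set X1 := {ω : BondConfig (Fin n) | ¬ (openGraph (offZ {v} ω)).Reachable o u ∧
    ((A.erase v).filter fun a => offZ {v} ω ∈ openConn o a).card ≤ 1} with hX1
  set X2 := {ω : BondConfig (Fin n) | ((A.erase v).filter fun a => offZ {v} ω ∈ openConn o a).card ≤ 1} with hX2
  set Y := {ω : BondConfig (Fin n) | ¬ (openGraph (offZ {v} ω)).Reachable o u ∧
    ((A.erase v).filter fun a => offZ {v} ω ∈ openConn o a).card = 1} with hY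
  set Zt := {ω : BondConfig (Fin n) | 2 ≤ ((A.erase v).filter fun a => offZ {v} ω ∈ openConn o a).card} with hZt
  set Zp := {ω : BondConfig (Fin n) | ¬ (openGraph (offZ {v} ω)).Reachable o u ∧
    1 ≤ ((A.erase v).filter fun a => offZ {v} ω ∈ openConn o a).card} with hZp
  set A' := (A.erase v).erase u with hA'
  set EK : ℝ := ∑ b ∈ A', μ.real {ω : BondConfig (Fin n) | offZ {v} ω ∈ openConn o b} with hEK
  set EF : ℝ := ∑ b ∈ A', μ.real {ω : BondConfig (Fin n) |
    ¬ (openGraph (offZ {v} ω)).Reachable o b ∧ (openGraph (offZ {v} ω)).Reachable u b} with hEF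
  -- the law (file II)
  have hN : μ.real {ω : BondConfig (Fin n) | (A.filter fun a => ω ∈ openConn o a).card ≤ 1} =
      p * (1 - r) * μ.real X0 + (1 - p) * r * μ.real X1 + (1 - p) * (1 - r) * μ.real X2 :=
    EarAtObserver.real_card_le_one_eq w hw hov huv hou hvA huA
  have hqv : μ.real (openConn o v) = p + (1 - p) * r * μ.real Gs := EarAtObserver.real_openConn_v_eq w hw hov huv hou
  have hqu : μ.real (openConn o u) = p * r + (1 - p * r) * μ.real Gs := EarAtObserver.real_openConn_u_eq w hw hov huv hou
  have hqb : ∀ b ∈ A', μ.real (openConn o b) = μ.real {ω : BondConfig (Fin n) | offZ {v} ω ∈ openConn o b} +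
      p * r * μ.real {ω : BondConfig (Fin n) | ¬ (openGraph (offZ {v} ω)).Reachable o b ∧ (openGraph (offZ {v} ω)).Reachable u b} := by
    intro b hb
    have hbv : b ≠ v := (mem_erase.1 (mem_erase.1 hb).2).1
    exact EarAtObserver.real_openConn_of_ne w hw hov huv hou hbv
  -- splitting the mean
  have huA' : u ∈ A.erase v := mem_erase.2 ⟨huv, huA⟩
  have hsumA : ∑ a ∈ A, μ.real (openConn o a) = μ.real (openConn o v) + μ.real (openConn o u) + ∑ b ∈ A', μ.real (openConn o b) := by
    rw [← add_sum_erase A _ hvA, ← add_sum_erase (A.erase v) _ huA', add_assoc]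
  have hsumb : ∑ b ∈ A', μ.real (openConn o b) = EK + p * r * EF := by
    rw [hEK, hEF, mul_sum, ← sum_add_distrib]
    exact sum_congr rfl hqb
  -- the first moments and the cells (file IIb)
  have hEKle := EarAtObserver.sum_real_reach_le (o := o) μ huv huA
  have hEFle := EarAtObserver.sum_real_feed_le (o := o) μ huv huA
  obtain ⟨c1, c2, c3, c4, c5, c6⟩ := EarAtObserver.real_cells (o := o) μ huv huA
  rw [probReal_univ] at c2 c3 c6
  -- marginal lower bounds from the cut hypothesis
  have hcomp : ∀ a : Fin n, μ.real (openConn o a : Set (BondConfig (Fin n)))ᶜ = 1 - μ.real (openConn o a) :=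
    fun a => probReal_compl_eq_one_sub (hmeas _)
  have hmv : 1 - t ≤ p + (1 - p) * r * μ.real Gs := by
    have := hcut v hvA; rw [hcomp, hqv] at this; linarith
  have hmu : 1 - t ≤ p * r + (1 - p * r) * μ.real Gs := by
    have := hcut u huA; rw [hcomp, hqu] at this; linarith
  have hmb : (A'.card : ℝ) * (1 - t) ≤ EK + p * r * EF := by
    rw [← hsumb]
    have h1 : ∀ b ∈ A', 1 - t ≤ μ.real (openConn o b) := by
      intro b hb
      have := hcut b (mem_of_mem_erase (mem_of_mem_erase hb)); rw [hcomp] at this; linarith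
    have := sum_le_sum h1
    rw [sum_const, nsmul_eq_mul] at this
    exact this
  -- the mean hypothesis in the same variables, and `|A'| ≥ 1`
  have hEN' : 2 < (p * r + (1 - p * r) * μ.real Gs) + (p + (1 - p) * r * μ.real Gs) + (EK + p * r * EF) := by
    rw [hsumA, hsumb, hqv, hqu] at hEN; linarith
  have hn : 1 ≤ A'.card := by
    by_contra h0
    have hA0 : A' = ∅ := by rw [← card_eq_zero]; omega
    have hEK0 : EK = 0 := by rw [hEK, hA0, sum_empty]
    have hEF0 : EF = 0 := by rw [hEF, hA0, sum_empty]
    have hv1 : μ.real (openConn o v) ≤ 1 := measureReal_le_one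
    have hu1 : μ.real (openConn o u) ≤ 1 := measureReal_le_one
    rw [hqv] at hv1; rw [hqu] at hu1
    rw [hEK0, hEF0] at hEN'
    linarith
  -- bookkeeping
  have key := EarAtObserver.arith p r (μ.real X0) (μ.real X1) (μ.real X2) (μ.real Gs) (μ.real Y) (μ.real Zt) (μ.real Zp)
    EK EF (1 - t) A'.card hn hp0 hp1 hr0 hr1 measureReal_nonneg c1 c2 c3 c4 c5 c6
    (by simpa only [one_mul] using hEKle) hEFle hmv hmu hmb hEN'
  rw [hN]
  linarith

/-- The same in the `(2·j < EN)` form of `Quant.FarRelayRow` at `j = 1`. [this work] -/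
theorem farRelayRow_one_of_earAtObserver (w : Sym2 (Fin n) → unitInterval) (A : Finset (Fin n)) {o v u : Fin n}
    (hov : o ≠ v) (huv : u ≠ v) (hou : o ≠ u) (hvA : v ∈ A) (huA : u ∈ A)
    (hw : ∀ z : Fin n, z ≠ o → z ≠ u → z ≠ v → (w s(v, z) : ℝ) = 0) (t : ℝ)
    (hEN : (2 * (1 : ℕ) : ℝ) < ∑ a ∈ A, (prodBernoulli w).real (openConn o a))
    (hcut : ∀ a ∈ A, (prodBernoulli w).real (openConn o a : Set (BondConfig (Fin n)))ᶜ ≤ t) :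
    (prodBernoulli w).real {ω : BondConfig (Fin n) | (A.filter fun a => ω ∈ openConn o a).card ≤ 1} ≤ t :=
  farLayerOne_of_earAtObserver w A hov huv hou hvA huA hw t (by push_cast at hEN; linarith) hcut

end Quant

end Summit.CriticalPhenomena.PercolationContinuityZ3.Theorems
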